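import Summits.NavierStokesRegularity.NavierStokesRegularity.Theorems.EfficiencyFloorLerayFloorGapAttainmentTransfer
import Summits.NavierStokesRegularity.NavierStokesRegularity.Theorems.EfficiencyFloorRigidExitReferenceShadowingScale
import Summits.NavierStokesRegularity.NavierStokesRegularity.Theorems.EfficiencyFloorRigidExitReferenceShadowingLimit
import HarnessLib

/-!
# Route `EfficiencyFloor`, crux `NearSaturationNearMaximiser` (stmt-NavierStokesRegularity-25482): TOOLS for the sequential
# core — the normalising symmetry `v ↦ (x ↦ l • (b • v (l • x)))` on the Lu–Doering functionals, and differences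

Helper file (`--supports stmt-NavierStokesRegularity-25482`), used by `…NearSaturationNearMaximiserSeqCore`. Elementary
covariance bookkeeping, all derived from the landed orbit covariance of `Z, Pal, S` (p839411, p839466: `Z ↦ lZ`, `Pal ↦ l³Pal`,
`S ↦ l³S` under the Navier–Stokes scaling `x ↦ l•m(l•x)`) and the amplitude scaling of `NSViscosityRescaling`
(`Z ↦ b²Z`, `Pal ↦ b²Pal`, `S ↦ b³S`):

* §1 `enstrophy_scale`, `palinstrophy_scale`, `stretching_scale`, `admissible_scale` — the orbit laws at `a = 0`, `R = 1`;
* §2 `enstrophy_const_smul`, `palinstrophy_const_smul`, `stretching_const_smul`, `admissible_const_smul`;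
* §3 `palinstrophy_sub_le` / `enstrophy_sub_le` (`Pal(f − g) ≤ 2Pal f + 2Pal g`, same for `Z`), the composite transport
  `T_{l,b} u = (x ↦ l•(b•u(l•x)))`: `Z ↦ l b² Z`, `Pal ↦ l³ b² Pal`, `S ↦ l³ b³ S`, admissibility, linearity (`transport_sub`),
  inversion (`transport_inv`), quarter powers;
* `normalisedMaximiser_scale` (normalised-maximiser identities along the scaling) and `normalisedMaximiser_of_unit`
  (a field with `Z = Pal = 1`, `S = c` is a normalised maximiser at `ν = 3c/4`).

HONEST FRAMING: identities and inequalities of vector calculus; nothing about stmt-25482, `LerayFloorGap`,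
`ProductionEfficiencyDecay` (stmt-22866) or Navier–Stokes regularity is decided; no summit statement is proved. [folklore]
-/

-- the problem directory repeats the summit name (`NavierStokesRegularity/NavierStokesRegularity`)
set_option linter.dupNamespace false

noncomputable section

namespace Summit.NavierStokesRegularity.NavierStokesRegularity.Theorems

namespace NearSaturationNearMaximiser

namespace SeqCore

open Set MeasureTheory Filter Topology Function
open scoped InnerProductSpace ENNReal
open Literature.Analysis.FluidPDE
open MaximiserSetRigidity.OrbitInvariance RigidExit.Resonance LerayFloorGap.Attainment RigidExit.ReferenceShadowing

/-! ## §1 The Navier–Stokes scaling `v ↦ (x ↦ l • v (l • x))` (orbit slice with `a = 0`, `R = 1`) -/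

/-- The plain scaling is the orbit slice with trivial translation and rotation (plumbing). [folklore] -/
theorem scale_eq_orbitSlice (m : EuclideanSpace ℝ (Fin 3) → EuclideanSpace ℝ (Fin 3)) (l : ℝ) :
    (fun x => l • m (l • x)) =
      fun x => l • (LinearIsometryEquiv.refl ℝ (EuclideanSpace ℝ (Fin 3)))
        (m (l • (LinearIsometryEquiv.refl ℝ (EuclideanSpace ℝ (Fin 3))).symm (x - 0))) := by
  funext x
  simp only [sub_zero]
  rfl

/-- Enstrophy under scaling: `Z(x ↦ l•m(l•x)) = l·Z(m)` (`l > 0`). [folklore] -/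
theorem enstrophy_scale (m : EuclideanSpace ℝ (Fin 3) → EuclideanSpace ℝ (Fin 3)) {l : ℝ} (hl : 0 < l) :
    ∫ x, ‖curl (fun x => l • m (l • x)) x‖ ^ 2 = l * ∫ x, ‖curl m x‖ ^ 2 := by
  rw [scale_eq_orbitSlice m l]
  exact integral_curl_sq_orbitSlice m 0 _ hl

/-- Palinstrophy under scaling: `Pal(x ↦ l•m(l•x)) = l³·Pal(m)` (`l > 0`). [folklore] -/
theorem palinstrophy_scale (m : EuclideanSpace ℝ (Fin 3) → EuclideanSpace ℝ (Fin 3)) {l : ℝ} (hl : 0 < l) :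
    ∫ x, frobeniusNormSq (fderiv ℝ (curl (fun x => l • m (l • x))) x) =
      l ^ 3 * ∫ x, frobeniusNormSq (fderiv ℝ (curl m) x) := by
  rw [scale_eq_orbitSlice m l]
  exact integral_palinstrophy_orbitSlice m 0 _ hl

/-- Stretching under scaling: `S(x ↦ l•m(l•x)) = l³·S(m)` (`l > 0`). [folklore] -/
theorem stretching_scale (m : EuclideanSpace ℝ (Fin 3) → EuclideanSpace ℝ (Fin 3)) {l : ℝ} (hl : 0 < l) :
    ∫ x, ⟪curl (fun x => l • m (l • x)) x, fderiv ℝ (fun x => l • m (l • x)) x (curl (fun x => l • m (l • x)) x)⟫_ℝ =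
      l ^ 3 * ∫ x, ⟪curl m x, fderiv ℝ m x (curl m x)⟫_ℝ := by
  rw [scale_eq_orbitSlice m l]
  exact integral_stretching_orbitSlice m 0 _ hl

/-- Admissibility under scaling (`l > 0`). [folklore] -/
theorem admissible_scale {m : EuclideanSpace ℝ (Fin 3) → EuclideanSpace ℝ (Fin 3)}
    (hm : ContDiff ℝ (⊤ : ℕ∞) m ∧ VectorCalculus.IsDivFree m ∧ (∫⁻ x, ‖iteratedFDeriv ℝ 0 m x‖ₑ ^ 2 < ⊤) ∧
      (∫⁻ x, ‖iteratedFDeriv ℝ 1 m x‖ₑ ^ 2 < ⊤) ∧ (∫⁻ x, ‖iteratedFDeriv ℝ 2 m x‖ₑ ^ 2 < ⊤)) {l : ℝ} (hl : 0 < l) :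
    ContDiff ℝ (⊤ : ℕ∞) (fun x => l • m (l • x)) ∧ VectorCalculus.IsDivFree (fun x => l • m (l • x)) ∧
      (∫⁻ x, ‖iteratedFDeriv ℝ 0 (fun x => l • m (l • x)) x‖ₑ ^ 2 < ⊤) ∧
      (∫⁻ x, ‖iteratedFDeriv ℝ 1 (fun x => l • m (l • x)) x‖ₑ ^ 2 < ⊤) ∧
      (∫⁻ x, ‖iteratedFDeriv ℝ 2 (fun x => l • m (l • x)) x‖ₑ ^ 2 < ⊤) := by
  rw [scale_eq_orbitSlice m l]
  exact admissible_orbitSlice hm 0 _ hl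

/-! ## §2 The amplitude scaling `v ↦ b • v` -/

/-- Enstrophy under amplitude scaling: `Z(b•m) = b²·Z(m)` (differentiable `m`). [folklore] -/
theorem enstrophy_const_smul {m : EuclideanSpace ℝ (Fin 3) → EuclideanSpace ℝ (Fin 3)} (hm : Differentiable ℝ m) (b : ℝ) :
    ∫ x, ‖curl (fun y => b • m y) x‖ ^ 2 = b ^ 2 * ∫ x, ‖curl m x‖ ^ 2 := by
  rw [curl_const_smul_eq hm b, ← integral_const_mul]
  refine integral_congr_ae (Eventually.of_forall fun x => ?_)
  simp only [norm_smul, mul_pow, Real.norm_eq_abs, sq_abs]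

/-- Palinstrophy under amplitude scaling: `Pal(b•m) = b²·Pal(m)` (`C²` `m`). [folklore] -/
theorem palinstrophy_const_smul {m : EuclideanSpace ℝ (Fin 3) → EuclideanSpace ℝ (Fin 3)} (hm : ContDiff ℝ 2 m) (b : ℝ) :
    ∫ x, frobeniusNormSq (fderiv ℝ (curl (fun y => b • m y)) x) = b ^ 2 * ∫ x, frobeniusNormSq (fderiv ℝ (curl m) x) := by
  rw [← integral_const_mul]
  refine integral_congr_ae (Eventually.of_forall fun x => ?_)
  simp only [fderiv_curl_const_smul hm b x, frobeniusNormSq_const_smul]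

/-- Stretching under amplitude scaling: `S(b•m) = b³·S(m)` (differentiable `m`). [folklore] -/
theorem stretching_const_smul {m : EuclideanSpace ℝ (Fin 3) → EuclideanSpace ℝ (Fin 3)} (hm : Differentiable ℝ m) (b : ℝ) :
    ∫ x, ⟪curl (fun y => b • m y) x, fderiv ℝ (fun y => b • m y) x (curl (fun y => b • m y) x)⟫_ℝ =
      b ^ 3 * ∫ x, ⟪curl m x, fderiv ℝ m x (curl m x)⟫_ℝ := by
  have hfd : ∀ x, fderiv ℝ (fun y => b • m y) x = b • fderiv ℝ m x := fun x => fderiv_fun_const_smul (hm x) b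
  rw [curl_const_smul_eq hm b, ← integral_const_mul]
  refine integral_congr_ae (Eventually.of_forall fun x => ?_)
  simp only [hfd x, FunLike.coe_smul, Pi.smul_apply, map_smul, real_inner_smul_left, real_inner_smul_right]
  ring

/-- Admissibility under amplitude scaling. [folklore] -/
theorem admissible_const_smul {m : EuclideanSpace ℝ (Fin 3) → EuclideanSpace ℝ (Fin 3)}
    (hm : ContDiff ℝ (⊤ : ℕ∞) m ∧ VectorCalculus.IsDivFree m ∧ (∫⁻ x, ‖iteratedFDeriv ℝ 0 m x‖ₑ ^ 2 < ⊤) ∧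
      (∫⁻ x, ‖iteratedFDeriv ℝ 1 m x‖ₑ ^ 2 < ⊤) ∧ (∫⁻ x, ‖iteratedFDeriv ℝ 2 m x‖ₑ ^ 2 < ⊤)) (b : ℝ) :
    ContDiff ℝ (⊤ : ℕ∞) (fun y => b • m y) ∧ VectorCalculus.IsDivFree (fun y => b • m y) ∧
      (∫⁻ x, ‖iteratedFDeriv ℝ 0 (fun y => b • m y) x‖ₑ ^ 2 < ⊤) ∧
      (∫⁻ x, ‖iteratedFDeriv ℝ 1 (fun y => b • m y) x‖ₑ ^ 2 < ⊤) ∧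
      (∫⁻ x, ‖iteratedFDeriv ℝ 2 (fun y => b • m y) x‖ₑ ^ 2 < ⊤) := by
  obtain ⟨hcd, hdiv, hL0, hL1, hL2⟩ := hm
  have hdiff : Differentiable ℝ m := hcd.differentiable (by simp)
  have hLk : ∀ k : ℕ, (∫⁻ x, ‖iteratedFDeriv ℝ k m x‖ₑ ^ 2 < ⊤) →
      (∫⁻ x, ‖iteratedFDeriv ℝ k (fun y => b • m y) x‖ₑ ^ 2 < ⊤) := by
    intro k hk
    have heq : ∀ x, iteratedFDeriv ℝ k (fun y => b • m y) x = b • iteratedFDeriv ℝ k m x := fun x =>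
      iteratedFDeriv_const_smul_apply' ((hcd.of_le (by norm_cast; exact le_top)).contDiffAt)
    simp_rw [heq]
    rw [lintegral_enorm_sq_const_smul]
    exact ENNReal.mul_lt_top ENNReal.ofReal_lt_top hk
  exact ⟨hcd.const_smul b, VectorCalculus.IsDivFree.const_smul hdiff hdiv b, hLk 0 hL0, hLk 1 hL1, hLk 2 hL2⟩

/-! ## §3 Differences: the palinstrophy of a difference, and exact scaling of differences -/

/-- `curl (f − g) = curl f − curl g` for differentiable fields (as functions). [folklore] -/
theorem curl_sub_eq {f g : EuclideanSpace ℝ (Fin 3) → EuclideanSpace ℝ (Fin 3)} (hf : Differentiable ℝ f)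
    (hg : Differentiable ℝ g) : curl (f - g) = fun x => curl f x - curl g x := by
  funext x
  rw [show f - g = fun y => f y - g y from rfl]
  exact curl_sub (hf x) (hg x)

/-- **Palinstrophy of a difference**: `Pal(f − g) ≤ 2·Pal(f) + 2·Pal(g)` for smooth fields with `D² ∈ L²`. [folklore] -/
theorem palinstrophy_sub_le {f g : EuclideanSpace ℝ (Fin 3) → EuclideanSpace ℝ (Fin 3)} (hf : ContDiff ℝ (⊤ : ℕ∞) f)
    (hg : ContDiff ℝ (⊤ : ℕ∞) g) (hf2 : ∫⁻ x, ‖iteratedFDeriv ℝ 2 f x‖ₑ ^ 2 < ⊤)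
    (hg2 : ∫⁻ x, ‖iteratedFDeriv ℝ 2 g x‖ₑ ^ 2 < ⊤) :
    ∫ x, frobeniusNormSq (fderiv ℝ (curl (f - g)) x) ≤
      2 * (∫ x, frobeniusNormSq (fderiv ℝ (curl f) x)) + 2 * ∫ x, frobeniusNormSq (fderiv ℝ (curl g) x) := by
  have hf3 : ContDiff ℝ 3 f := hf.of_le (by norm_cast)
  have hg3 : ContDiff ℝ 3 g := hg.of_le (by norm_cast)
  have hcf : ContDiff ℝ 1 (curl f) := contDiff_curl (n := 1) (hf.of_le (by exact_mod_cast le_top))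
  have hcg : ContDiff ℝ 1 (curl g) := contDiff_curl (n := 1) (hg.of_le (by exact_mod_cast le_top))
  have hsub : curl (f - g) = fun x => curl f x - curl g x :=
    curl_sub_eq (hf.differentiable (by simp)) (hg.differentiable (by simp))
  have hfd : ∀ x, fderiv ℝ (curl (f - g)) x = fderiv ℝ (curl f) x - fderiv ℝ (curl g) x := fun x => by
    rw [hsub]
    exact fderiv_fun_sub ((hcf.differentiable one_ne_zero) x) ((hcg.differentiable one_ne_zero) x)
  have If := (integrable_frobeniusNormSq_fderiv_curl hf3 hf2).1
  have Ig := (integrable_frobeniusNormSq_fderiv_curl hg3 hg2).1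
  calc ∫ x, frobeniusNormSq (fderiv ℝ (curl (f - g)) x)
      ≤ ∫ x, (2 * frobeniusNormSq (fderiv ℝ (curl f) x) + 2 * frobeniusNormSq (fderiv ℝ (curl g) x)) := by
        refine integral_mono_of_nonneg (Eventually.of_forall fun x => frobeniusNormSq_nonneg _)
          ((If.const_mul 2).add (Ig.const_mul 2)) (Eventually.of_forall fun x => ?_)
        simp only [hfd x]
        exact frobeniusNormSq_sub_le _ _
    _ = 2 * (∫ x, frobeniusNormSq (fderiv ℝ (curl f) x)) + 2 * ∫ x, frobeniusNormSq (fderiv ℝ (curl g) x) := by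
        rw [integral_add (If.const_mul 2) (Ig.const_mul 2), integral_const_mul, integral_const_mul]

/-- **Enstrophy of a difference**: `Z(f − g) ≤ 2·Z(f) + 2·Z(g)` for smooth fields with `D¹ ∈ L²`. [folklore] -/
theorem enstrophy_sub_le {f g : EuclideanSpace ℝ (Fin 3) → EuclideanSpace ℝ (Fin 3)} (hf : ContDiff ℝ (⊤ : ℕ∞) f)
    (hg : ContDiff ℝ (⊤ : ℕ∞) g) (hf1 : ∫⁻ x, ‖iteratedFDeriv ℝ 1 f x‖ₑ ^ 2 < ⊤)
    (hg1 : ∫⁻ x, ‖iteratedFDeriv ℝ 1 g x‖ₑ ^ 2 < ⊤) :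
    ∫ x, ‖curl (f - g) x‖ ^ 2 ≤ 2 * (∫ x, ‖curl f x‖ ^ 2) + 2 * ∫ x, ‖curl g x‖ ^ 2 := by
  have hsub : curl (f - g) = fun x => curl f x - curl g x :=
    curl_sub_eq (hf.differentiable (by simp)) (hg.differentiable (by simp))
  have If := (integrable_norm_curl_sq (hf.of_le (by norm_cast)) hf1).1
  have Ig := (integrable_norm_curl_sq (hg.of_le (by norm_cast)) hg1).1
  calc ∫ x, ‖curl (f - g) x‖ ^ 2 ≤ ∫ x, (2 * ‖curl f x‖ ^ 2 + 2 * ‖curl g x‖ ^ 2) := by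
        refine integral_mono_of_nonneg (Eventually.of_forall fun x => by positivity)
          ((If.const_mul 2).add (Ig.const_mul 2)) (Eventually.of_forall fun x => ?_)
        simp only [hsub]
        have h1 : ‖curl f x - curl g x‖ ^ 2 ≤ (‖curl f x‖ + ‖curl g x‖) ^ 2 :=
          pow_le_pow_left₀ (norm_nonneg _) (norm_sub_le _ _) 2
        nlinarith [sq_nonneg (‖curl f x‖ - ‖curl g x‖)]
    _ = 2 * (∫ x, ‖curl f x‖ ^ 2) + 2 * ∫ x, ‖curl g x‖ ^ 2 := by
        rw [integral_add (If.const_mul 2) (Ig.const_mul 2), integral_const_mul, integral_const_mul]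

/-- The composite scaling is linear: `T(f) − T(g) = T(f − g)` for `T u = (x ↦ l • (b • u (l • x)))` (plumbing). [folklore] -/
theorem transport_sub (f g : EuclideanSpace ℝ (Fin 3) → EuclideanSpace ℝ (Fin 3)) (l b : ℝ) :
    ((fun x => l • (b • f (l • x))) - fun x => l • (b • g (l • x))) = fun x => l • (b • (f - g) (l • x)) := by
  funext x
  simp only [Pi.sub_apply, smul_sub]

/-- Enstrophy under the composite scaling: `Z(x ↦ l•(b•u(l•x))) = l·b²·Z(u)` (`l > 0`, `u` differentiable). [folklore] -/
theorem enstrophy_transport {u : EuclideanSpace ℝ (Fin 3) → EuclideanSpace ℝ (Fin 3)} (hu : Differentiable ℝ u)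
    {l : ℝ} (hl : 0 < l) (b : ℝ) :
    ∫ x, ‖curl (fun x => l • (b • u (l • x))) x‖ ^ 2 = l * b ^ 2 * ∫ x, ‖curl u x‖ ^ 2 := by
  have h := enstrophy_scale (fun y => b • u y) hl
  rw [h, enstrophy_const_smul hu b, mul_assoc]

/-- Palinstrophy under the composite scaling: `Pal(x ↦ l•(b•u(l•x))) = l³·b²·Pal(u)` (`l > 0`, `u ∈ C²`). [folklore] -/
theorem palinstrophy_transport {u : EuclideanSpace ℝ (Fin 3) → EuclideanSpace ℝ (Fin 3)} (hu : ContDiff ℝ 2 u)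
    {l : ℝ} (hl : 0 < l) (b : ℝ) :
    ∫ x, frobeniusNormSq (fderiv ℝ (curl (fun x => l • (b • u (l • x)))) x) =
      l ^ 3 * b ^ 2 * ∫ x, frobeniusNormSq (fderiv ℝ (curl u) x) := by
  have h := palinstrophy_scale (fun y => b • u y) hl
  rw [h, palinstrophy_const_smul hu b, mul_assoc]

/-- Stretching under the composite scaling: `S(x ↦ l•(b•u(l•x))) = l³·b³·S(u)` (`l > 0`, `u` differentiable). [folklore] -/
theorem stretching_transport {u : EuclideanSpace ℝ (Fin 3) → EuclideanSpace ℝ (Fin 3)} (hu : Differentiable ℝ u)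
    {l : ℝ} (hl : 0 < l) (b : ℝ) :
    ∫ x, ⟪curl (fun x => l • (b • u (l • x))) x,
        fderiv ℝ (fun x => l • (b • u (l • x))) x (curl (fun x => l • (b • u (l • x))) x)⟫_ℝ =
      l ^ 3 * b ^ 3 * ∫ x, ⟪curl u x, fderiv ℝ u x (curl u x)⟫_ℝ := by
  have h := stretching_scale (fun y => b • u y) hl
  rw [h, stretching_const_smul hu b, mul_assoc]

/-- Admissibility under the composite scaling (`l > 0`). [folklore] -/
theorem admissible_transport {u : EuclideanSpace ℝ (Fin 3) → EuclideanSpace ℝ (Fin 3)}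
    (hu : ContDiff ℝ (⊤ : ℕ∞) u ∧ VectorCalculus.IsDivFree u ∧ (∫⁻ x, ‖iteratedFDeriv ℝ 0 u x‖ₑ ^ 2 < ⊤) ∧
      (∫⁻ x, ‖iteratedFDeriv ℝ 1 u x‖ₑ ^ 2 < ⊤) ∧ (∫⁻ x, ‖iteratedFDeriv ℝ 2 u x‖ₑ ^ 2 < ⊤)) {l : ℝ} (hl : 0 < l) (b : ℝ) :
    ContDiff ℝ (⊤ : ℕ∞) (fun x => l • (b • u (l • x))) ∧ VectorCalculus.IsDivFree (fun x => l • (b • u (l • x))) ∧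
      (∫⁻ x, ‖iteratedFDeriv ℝ 0 (fun x => l • (b • u (l • x))) x‖ₑ ^ 2 < ⊤) ∧
      (∫⁻ x, ‖iteratedFDeriv ℝ 1 (fun x => l • (b • u (l • x))) x‖ₑ ^ 2 < ⊤) ∧
      (∫⁻ x, ‖iteratedFDeriv ℝ 2 (fun x => l • (b • u (l • x))) x‖ₑ ^ 2 < ⊤) := by
  have h := admissible_scale (admissible_const_smul hu b) hl
  simpa only using h

/-- The composite scaling is undone by the inverse parameters: `l⁻¹ • (b⁻¹ • (l • (b • u (l • (l⁻¹ • x))))) = u x`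
(`l, b ≠ 0`; plumbing). [folklore] -/
theorem transport_inv (u : EuclideanSpace ℝ (Fin 3) → EuclideanSpace ℝ (Fin 3)) {l b : ℝ} (hl : l ≠ 0) (hb : b ≠ 0) :
    (fun x => l⁻¹ • (b⁻¹ • (fun y => l • (b • u (l • y))) (l⁻¹ • x))) = u := by
  funext x
  simp only [smul_smul]
  rw [show l⁻¹ * (b⁻¹ * (l * b)) = 1 by field_simp, mul_inv_cancel₀ hl, one_smul, one_smul]

/-- Quarter powers (plumbing): for `Z ≥ 0`, `(Z^{1/4})⁴ = Z` and `Z^{3/4} = (Z^{1/4})³`. [folklore] -/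
theorem rpow_quarter_pow {Z : ℝ} (hZ : 0 ≤ Z) : (Z ^ (1 / 4 : ℝ)) ^ 4 = Z ∧ Z ^ (3 / 4 : ℝ) = (Z ^ (1 / 4 : ℝ)) ^ 3 := by
  constructor
  · rw [← Real.rpow_natCast, ← Real.rpow_mul hZ]; norm_num
  · rw [← Real.rpow_natCast, ← Real.rpow_mul hZ]; norm_num

/-- Normalised-maximiser identities transfer under the plain scaling `m ↦ (x ↦ l • m (l • x))` (`l > 0`). [folklore] -/
theorem normalisedMaximiser_scale {c ν : ℝ} {m : EuclideanSpace ℝ (Fin 3) → EuclideanSpace ℝ (Fin 3)}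
    (hm : ((ContDiff ℝ (⊤ : ℕ∞) m ∧ VectorCalculus.IsDivFree m ∧
      (∫⁻ x, ‖iteratedFDeriv ℝ 0 m x‖ₑ ^ 2 < ⊤) ∧ (∫⁻ x, ‖iteratedFDeriv ℝ 1 m x‖ₑ ^ 2 < ⊤) ∧
      (∫⁻ x, ‖iteratedFDeriv ℝ 2 m x‖ₑ ^ 2 < ⊤)) ∧ 0 < (∫ x, ‖curl m x‖ ^ 2) ∧
      (∫ x, ⟪curl m x, fderiv ℝ m x (curl m x)⟫_ℝ) =
        c * (∫ x, ‖curl m x‖ ^ 2) ^ (3 / 4 : ℝ) * (∫ x, frobeniusNormSq (fderiv ℝ (curl m) x)) ^ (3 / 4 : ℝ) ∧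
      (∫ x, frobeniusNormSq (fderiv ℝ (curl m) x)) = 81 * c ^ 4 / (256 * ν ^ 4) * (∫ x, ‖curl m x‖ ^ 2) ^ 3))
    {l : ℝ} (hl : 0 < l) :
    (ContDiff ℝ (⊤ : ℕ∞) (fun x => l • m (l • x)) ∧ VectorCalculus.IsDivFree (fun x => l • m (l • x)) ∧
      (∫⁻ x, ‖iteratedFDeriv ℝ 0 (fun x => l • m (l • x)) x‖ₑ ^ 2 < ⊤) ∧
      (∫⁻ x, ‖iteratedFDeriv ℝ 1 (fun x => l • m (l • x)) x‖ₑ ^ 2 < ⊤) ∧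
      (∫⁻ x, ‖iteratedFDeriv ℝ 2 (fun x => l • m (l • x)) x‖ₑ ^ 2 < ⊤)) ∧
    0 < (∫ x, ‖curl (fun x => l • m (l • x)) x‖ ^ 2) ∧
    (∫ x, ⟪curl (fun x => l • m (l • x)) x, fderiv ℝ (fun x => l • m (l • x)) x (curl (fun x => l • m (l • x)) x)⟫_ℝ) =
      c * (∫ x, ‖curl (fun x => l • m (l • x)) x‖ ^ 2) ^ (3 / 4 : ℝ) *
        (∫ x, frobeniusNormSq (fderiv ℝ (curl (fun x => l • m (l • x))) x)) ^ (3 / 4 : ℝ) ∧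
    (∫ x, frobeniusNormSq (fderiv ℝ (curl (fun x => l • m (l • x))) x)) =
      81 * c ^ 4 / (256 * ν ^ 4) * (∫ x, ‖curl (fun x => l • m (l • x)) x‖ ^ 2) ^ 3 := by
  rw [scale_eq_orbitSlice m l]
  exact normalisedMaximiser_orbitSlice hm 0 _ hl

/-- A field with `Z = Pal = 1` and `S = c` is a normalised maximiser at the viscosity `ν = 3c/4` (where the normalisation
`Pal = (81c⁴/(256ν⁴))·Z³` reads `Pal = Z³`). [folklore] -/
theorem normalisedMaximiser_of_unit {c : ℝ} (hc : 0 < c) {m : EuclideanSpace ℝ (Fin 3) → EuclideanSpace ℝ (Fin 3)}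
    (hm : ContDiff ℝ (⊤ : ℕ∞) m ∧ VectorCalculus.IsDivFree m ∧
      (∫⁻ x, ‖iteratedFDeriv ℝ 0 m x‖ₑ ^ 2 < ⊤) ∧ (∫⁻ x, ‖iteratedFDeriv ℝ 1 m x‖ₑ ^ 2 < ⊤) ∧
      (∫⁻ x, ‖iteratedFDeriv ℝ 2 m x‖ₑ ^ 2 < ⊤))
    (hZ : (∫ x, ‖curl m x‖ ^ 2) = 1) (hP : (∫ x, frobeniusNormSq (fderiv ℝ (curl m) x)) = 1)
    (hS : (∫ x, ⟪curl m x, fderiv ℝ m x (curl m x)⟫_ℝ) = c) :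
    (ContDiff ℝ (⊤ : ℕ∞) m ∧ VectorCalculus.IsDivFree m ∧
      (∫⁻ x, ‖iteratedFDeriv ℝ 0 m x‖ₑ ^ 2 < ⊤) ∧ (∫⁻ x, ‖iteratedFDeriv ℝ 1 m x‖ₑ ^ 2 < ⊤) ∧
      (∫⁻ x, ‖iteratedFDeriv ℝ 2 m x‖ₑ ^ 2 < ⊤)) ∧ 0 < (∫ x, ‖curl m x‖ ^ 2) ∧
      (∫ x, ⟪curl m x, fderiv ℝ m x (curl m x)⟫_ℝ) =
        c * (∫ x, ‖curl m x‖ ^ 2) ^ (3 / 4 : ℝ) * (∫ x, frobeniusNormSq (fderiv ℝ (curl m) x)) ^ (3 / 4 : ℝ) ∧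
      (∫ x, frobeniusNormSq (fderiv ℝ (curl m) x)) = 81 * c ^ 4 / (256 * (3 * c / 4) ^ 4) * (∫ x, ‖curl m x‖ ^ 2) ^ 3 := by
  refine ⟨hm, by rw [hZ]; exact one_pos, ?_, ?_⟩
  · rw [hS, hZ, hP, Real.one_rpow]; ring
  · rw [hP, hZ]
    have hc0 : c ≠ 0 := hc.ne'
    field_simp
    ring

end SeqCore

end NearSaturationNearMaximiser

end Summit.NavierStokesRegularity.NavierStokesRegularity.Theorems

end
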